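import Summits.ResolutionOfSingularities.ResolutionOfSingularities.Theorems.FrobeniusClosingSteerHevLeafMaxNoDropRecut
import HarnessLib

/-!
# (MAX-ND)ᴵ — the EXIT-FREE CORE: every AFFINE EXIT closes the datum (PROVED), so the even frontier may assume there is none
  (res-L0-w41-strat-1 g11, crux-strategist object (MAX-CL∞)ᴵ per res-L0-w41-plan-1 RULING 262 (b); SIGNATURES + PROVED closer + PROVED glue; 0 sorries)

An **affine exit** of the datum `(O, A₀, t)` at exponent `p` is a stage `S = R N` of SOME finite tower of local blowings up along `O` from the start
member `locAtCentre A₀ O` (Novacoski–Spivakovsky Def. 2.8; NO torsor bookkeeping `s i = x·s (i+1) + g` is required), `S` local, together with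
`a b z ∈ S`, `b ≠ 0`, such that

  `t ^ p = a ^ p + b ^ p · z`  and the torsor germ  `S_𝔪[T]/(T ^ p − z)`  is a REGULAR local ring

(for `p = 2` and `S` regular with perfect residue field the last clause is `∀ g : S, z − g² ∉ 𝔪²`, tree
`RadicandSingular.not_isRegularLocalRing_adjoinRoot_atMaximalIdeal_iff`). Then `w := (t − a)/b` has `w ^ p = z`, `t = a + b·w ∈ S[w]`, and the landed
`SteeredExit.concl_of_radicandRing_regular` (p479657 packaging) gives `Concl O A₀ t` — `AffineExit.concl_of_hasAffineExit`, PROVED below.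

Every exit closer on record is an affine exit: the tower exit of `SteeredExit.concl_of_exit` (`a = G`, `b = X` from `t = X·s N + G`), the ORDER-ONE exit,
and — once res-D-brk-2ʼs K-TX lands — every UNIT-DOMINANT ODD STAGE `ToricUnitExit.HasUnitDominantOddStage O A₀ t` (K-TX = «unit-dominant odd stage ⇒
toric tower ⇒ regular germ», i.e. `HasUnitDominantOddStage → HasAffineExit`). Conversely an affine exit is invisible to the value group and to the
`g`-recursion of cleaning: in Kähler terms it says that at `S` the JACOBIAN IDEAL `J_S(t^p) = (∂f/∂y_j)_j` of the radicand is PRINCIPAL AND GENERATED BY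
A `p`-TH POWER, `J_S(f) = (b^p)` — equivalently (p = 2) the exact `2`-closed codimension-one foliation `ker d f` of the regular models of `K₀ = Frac A₀` is
NON-SINGULAR at the centre of `O` on `S` (memo `L/res-L0-w41-strat-1/OMEGA-LINE-1.md`).

Hence the RECUT (pure logic, PROVED): **(MAX-ND)ᴵ ⟸ (MAX-EF)ᴵ**, where

* (MAX-EF)ᴵ `HevLeaf.DropSplit.StrippingTailSwitchingEvenInfMaxNoDropExitFreeConclIndTwoN` := (MAX-ND)ᴵ VERBATIM with ONE extra hypothesis
  `¬ AffineExit.HasAffineExit O A₀ t p` inserted before the inductive binder — «NO stage of ANY tower of local blowings up from the start carries an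
  affine exit»: the EXIT-FREE CORE of the even side. It implies tri-1ʼs residual (MAX-CL∞)ᴵ `…MaxNoDropClusterConclIndTwoN` (tree, p562405) outright (`…ClusterConclIndTwoN_of_exitFree`,
  PROVED; the binder `¬ HasUnitDominantOddStage` unused) and is implied by it given K-TX; it needs NO toric machinery to feed (MAX-ND)ᴵ.

Kill shape of (MAX-EF)ᴵ: a hev-∞ MAXGEN datum whose radicandʼs Jacobian ideal never becomes a principal square along `O` AND which has no regular
model — by the Kunz/Jacobson dictionary (memo §3) a regular model `S' ∋ t` of `K` whose `p`-closed derivation `∂_t` is non-singular at the centre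
yields an affine exit at `S' ∩ K₀`, so modulo rank-one foliation uniformization for `(K, ∂_t)` (route `FoliationDescent`, crux `FolLU`, p = 2, trdeg 4)
(MAX-EF)ᴵ is EQUIVALENT to «every datum of its hypothesis class HAS an affine exit», i.e. to non-singularization of `ker d f` along `O`.

OURS (campaign res-hironaka, rung L ★L-G4, slot W4.1, crux `Steer` stmt-ResolutionOfSingularities-16345); candidates, not facts; replaces the role of no
printed item; NOT a statement of the manuscript under review [claim: Hironaka2017, status: under-review]; AI review is weaker than expert review.
[cite: NovacoskiSpivakovsky2014, Def. 2.8, Lemma 2.5, Lemma 2.9] [cite: Matsumura1987, Thm. 19.3] (folklore)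
-/

-- `Summit.<S>.<S>.…` duplicates the summit name by design (single-problem summit).
set_option linter.dupNamespace false

noncomputable section

open Polynomial IsLocalRing
open Literature.AlgebraicGeometry.Resolution
open Summit.ResolutionOfSingularities.ResolutionOfSingularities.Theorems.SwitchingDichotomy.Words
open Summit.ResolutionOfSingularities.ResolutionOfSingularities.Theorems.SteerRankThinness (Concl HasProperCoarsening)
open Summit.ResolutionOfSingularities.ResolutionOfSingularities.Theorems.SwitchingDichotomy.ArithReduction
open Summit.ResolutionOfSingularities.ResolutionOfSingularities.Theorems.SwitchingDichotomy

namespace Summit.ResolutionOfSingularities.ResolutionOfSingularities.Theorems.SwitchingDichotomy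

namespace AffineExit

variable {k K : Type} [Field k] [Field K] [Algebra k K]

/-- **`HasAffineExit O A₀ t p`**: SOME finite tower of local blowings up along `O` from the start member `locAtCentre A₀ O` ends at a local stage
`R N` carrying `a b z ∈ R N`, `b ≠ 0`, with `t ^ p = a ^ p + b ^ p · z` and the torsor germ `(R N)_𝔪[T]/(T ^ p − z)` a REGULAR local ring.
(No torsor-generator bookkeeping along the tower; `IsLocalBlowup` may adjoin any finite subset of `O`.) OURS. (ref. NovacoskiSpivakovsky2014, Def. 2.8)
(folklore) -/
def HasAffineExit (O : ValuationSubring K) (A₀ : Subalgebra k K) (t : K) (p : ℕ) : Prop :=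
  ∃ (R : ℕ → Subring K) (N : ℕ), R 0 = locAtCentre A₀.toSubring O ∧
    (∀ i < N, IsLocalBlowup O (R i) (R (i + 1))) ∧
    ∃ (_ : IsLocalRing (R N)) (a b z : R N), (b : K) ≠ 0 ∧
      t ^ p = (a : K) ^ p + (b : K) ^ p * (z : K) ∧
      IsRegularLocalRing (AdjoinRoot
        (X ^ p - C (algebraMap (R N) (Localization.AtPrime (maximalIdeal (R N))) z)))

/-- **AFFINE EXITS CLOSE THE DATUM (PROVED).** For `A₀ ⊆ O` finitely generated with `Frac (A₀[t]) = K`, `p` prime `= char K`: an affine exit gives a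
finitely generated `A ⊇ A₀` with `t ∈ A ⊆ O`, `Frac A = K`, regular at the centre of `O` — namely `A = A₁[t][w]` for the model `A₁` of the tower and
`w = (t − a)/b` (`w ^ p = z`, `t = a + b·w`), by `SteeredExit.concl_of_radicandRing_regular`. OURS.
[cite: NovacoskiSpivakovsky2014, Def. 2.8, Lemma 2.5, Lemma 2.9] [cite: Matsumura1987, Thm. 19.3] (folklore) -/
theorem concl_of_hasAffineExit {p : ℕ} [CharP K p] (hp : p.Prime) (O : ValuationSubring K) (A₀ : Subalgebra k K)
    (h₀ : A₀.toSubring ≤ O.toSubring) (t : K) (hfg : A₀.FG)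
    (hfr : IsFractionRing (Algebra.adjoin k (insert t (A₀ : Set K))) K) (h : HasAffineExit O A₀ t p) :
    Concl O A₀ t := by
  classical
  haveI : Fact p.Prime := ⟨hp⟩
  obtain ⟨R, N, hR0, hstep, hloc, a, b, z, hb, ht, hreg⟩ := h
  obtain ⟨A₁, h₁, hle, hfg₁, hRN⟩ := SteeredExit.exists_model_of_tower O A₀ h₀ hfg hR0 (N := N) hstep
  -- the generator `w = (t - a)/b`
  set w : K := (t - (a : K)) / (b : K) with hw_def
  have hbp : (b : K) ^ p ≠ 0 := pow_ne_zero _ hb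
  have hwp : w ^ p = (z : K) := by
    rw [hw_def, div_pow, sub_pow_char t (a : K), ht]
    field_simp
    ring
  have hwS : w ^ p ∈ R N := by rw [hwp]; exact z.2
  have htw : t = (b : K) * w + (a : K) := by
    rw [hw_def, mul_div_cancel₀ _ hb]
    ring
  have htcl : t ∈ Subring.closure (insert w (R N : Set K)) := by
    rw [htw]
    exact Subring.add_mem _
      (Subring.mul_mem _ (Subring.subset_closure (Set.mem_insert_of_mem _ b.2))
        (Subring.subset_closure (Set.mem_insert _ _)))
      (Subring.subset_closure (Set.mem_insert_of_mem _ a.2))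
  have hzw : (⟨w ^ p, hwS⟩ : R N) = z := Subtype.ext hwp
  haveI := hloc
  have hreg' : IsRegularLocalRing (AdjoinRoot
      (X ^ p - C (algebraMap (R N) (Localization.AtPrime (maximalIdeal (R N))) ⟨w ^ p, hwS⟩))) := by
    rw [hzw]; exact hreg
  exact SteeredExit.concl_of_radicandRing_regular O A₀ A₁ h₁ hle hfg₁ (R N) hloc hRN t w hfr hp.pos hwS htcl hreg'

/-- A tower exit in the sense of `SteeredExit.concl_of_exit` (`s 0 = t`, steps `s i = x·s (i+1) + g`, regular germ of `s N ^ p` at `R N`) at which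
`t ∉ R N` IS an affine exit (`a = G`, `b = X ≠ 0` from `t = X·s N + G`). PROVED; recorded so that the exits of record are visibly affine exits.
OURS. (folklore) -/
theorem hasAffineExit_of_towerExit {p : ℕ} [CharP K p] (hp : p.Prime) (O : ValuationSubring K) (A₀ : Subalgebra k K) (t : K)
    (R : ℕ → Subring K) (hR0 : R 0 = locAtCentre A₀.toSubring O) (s : ℕ → K) (N : ℕ) (hs0 : s 0 = t)
    (hstep : ∀ i < N, IsLocalBlowup O (R i) (R (i + 1)) ∧
      ∃ x g : K, x ∈ R i ∧ g ∈ R i ∧ s i = x * s (i + 1) + g)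
    (hloc : IsLocalRing (R N)) (hsN : s N ^ p ∈ R N) (htN : t ∉ R N)
    (hreg : IsRegularLocalRing (AdjoinRoot
      (X ^ p - C (algebraMap (R N) (Localization.AtPrime (maximalIdeal (R N))) ⟨s N ^ p, hsN⟩)))) :
    HasAffineExit O A₀ t p := by
  obtain ⟨Xe, hX, G, hG, htXG⟩ := SteeredExit.exists_eq_mul_add_of_steps (R := R) hs0
    (fun i hi => (hstep i hi).1.le) fun i hi => (hstep i hi).2
  have hX0 : Xe ≠ 0 := by
    rintro rfl
    apply htN
    rw [htXG, zero_mul, zero_add]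
    exact hG
  haveI : Fact p.Prime := ⟨hp⟩
  refine ⟨R, N, hR0, fun i hi => (hstep i hi).1, hloc, ⟨G, hG⟩, ⟨Xe, hX⟩, ⟨s N ^ p, hsN⟩, hX0, ?_, hreg⟩
  show t ^ p = G ^ p + Xe ^ p * s N ^ p
  rw [htXG, add_pow_char, mul_pow]
  ring

end AffineExit

namespace HevLeaf

namespace DropSplit

variable {k K : Type} [Field k] [Field K] [Algebra k K]

/-- **(MAX-EF)ᴵ `StrippingTailSwitchingEvenInfMaxNoDropExitFreeConclIndTwoN`** — (MAX-ND)ᴵ `StrippingTailSwitchingEvenInfMaxNoDropConclIndTwoN`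
VERBATIM with ONE extra hypothesis `¬ AffineExit.HasAffineExit O A₀ t p` (inserted before the inductive binder): NO stage of ANY finite tower of local
blowings up along `O` from the start carries an affine exit `t ^ p = a ^ p + b ^ p·z` with regular germ. THE EXIT-FREE CORE of the even side: every
exit closer on record (order-one, tower, toric/K-TX) is excluded by hypothesis; no inhabitant of record (all witnesses W8⁺/W10/W10⁺/W14e/N-family have an
affine exit); kill shape = a datum of this class with no regular model, i.e. failure of local uniformization along `O`; modulo rank-one foliation
uniformization for `(K, ∂_t)` it is equivalent to «the class is empty». Why it might fail: it is the open problem of the leaf. OURS. (folklore) -/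
def StrippingTailSwitchingEvenInfMaxNoDropExitFreeConclIndTwoN : Prop :=
  ∀ p : ℕ, p = 2 →
    ∀ (k K : Type) [Field k] [CharP k p] [PerfectField k] [Field K] [Algebra k K]
    (O : ValuationSubring K) (A₀ : Subalgebra k K) (h₀ : A₀.toSubring ≤ O.toSubring) (t : K),
    CoreDatum p 4 k K O A₀ h₀ t → ¬ HasProperCoarsening O →
    ∀ (R : ℕ → Subring K) (P : (i : ℕ) → Ideal (R i)) (s : ℕ → K),
      R 0 = locAtCentre A₀.toSubring O → NormalAt O (R 0) p t → IsSteeredRun O R P t p s →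
      (¬ ∃ i₀ c : ℕ, 1 ≤ c ∧ IsDominantTail R P i₀ c) →
      (∃ i₀ : ℕ, ∀ i, i₀ ≤ i → IsHighOrderAt R s p i) →
      ¬ HeightTwoStepsInfinite R P → {j | IsPosStep R P j}.Infinite →
      (∀ i₀ : ℕ, ∃ i, i₀ ≤ i ∧ IsPointStep R P i ∧
        ∀ hs : s i ^ p ∈ R i, ¬ HasIsolatedSingularity (RadicandRing (R i) p ⟨s i ^ p, hs⟩)) →
      (¬ ∃ i₀ : ℕ, ∃ x : K, x ≠ 0 ∧ x ∈ O ∧ O.valuation x < 1 ∧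
        ∀ i, i₀ ≤ i → ∀ y ∈ R i, O.valuation y < 1 → ∃ j, i < j ∧ y / x ∈ R j) →
      (∃ i₀ : ℕ, ∀ i, i₀ ≤ i → ¬ OddCleanedPointStepAt R P s p i) →
      (∃ i₀ e : ℕ, 2 ≤ e ∧ (∀ i, i₀ ≤ i → IsPointStep R P i → BinaryResiduePointStepAt R P s p (2 * e) i) ∧
        ¬ OrderInduction.CleanerReaches p O A₀.toSubring t (2 * e + 1)) →
      (∀ i₀ : ℕ, ∃ i i' : ℕ, i₀ ≤ i ∧ IsSatellitePair R P i i') →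
      (∃ i₀ : ℕ, ∀ i i' : ℕ, i₀ ≤ i → IsSatellitePair R P i i' → ¬ NoSingularSurfaceAt R s p i') →
      (∃ i₀ : ℕ, ∀ i, i₀ ≤ i → IsPointStep R P i → IsMaxGenAt (R i) p t (s i)) →
      ¬ AffineExit.HasAffineExit O A₀ t p →
      OrderInduction.ConclBelowDatum p k K O A₀ t →
      Concl O A₀ t

/-- **GLUE (PROVED): (MAX-ND)ᴵ ⟸ (MAX-EF)ᴵ** — excluded middle on `AffineExit.HasAffineExit O A₀ t p`; the exit case is
`AffineExit.concl_of_hasAffineExit` (`A₀.FG`, `Frac (A₀[t]) = K` are the first fields of `CoreDatum`; `CharP K 2` along `algebraMap k K`).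
No toric machinery is used. OURS. (folklore) -/
theorem strippingTailSwitchingEvenInfMaxNoDropConclIndTwoN_of_exitFree
    (hEF : StrippingTailSwitchingEvenInfMaxNoDropExitFreeConclIndTwoN) :
    StrippingTailSwitchingEvenInfMaxNoDropConclIndTwoN := by
  intro p hp2 k K _ _ _ _ _ O A₀ h₀ t core hrk R P s hR0 hN hrun hnd hhigh h2 hinf hwild hsw hev hbin hsat hsing hmax hbelow
  by_cases hAE : AffineExit.HasAffineExit O A₀ t p
  · subst hp2
    haveI : CharP K 2 := charP_of_injective_algebraMap (algebraMap k K).injective 2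
    obtain ⟨hfg, htp, hfr, -⟩ := core
    exact AffineExit.concl_of_hasAffineExit Nat.prime_two O A₀ h₀ t hfg hfr hAE
  · exact hEF p hp2 k K O A₀ h₀ t core hrk R P s hR0 hN hrun hnd hhigh h2 hinf hwild hsw hev hbin hsat hsing hmax hAE hbelow

/-- **GLUE (PROVED): (MAX-CL∞)ᴵ ⟸ (MAX-EF)ᴵ** — tri-1ʼs residual `StrippingTailSwitchingEvenInfMaxNoDropClusterConclIndTwoN` (p562405) follows from the
exit-free core by the same excluded middle; its binder `¬ ToricUnitExit.HasUnitDominantOddStage O A₀ t` is not used (so the T-line hunk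
`hMaxND ↦ hKTX · hCL∞` may be followed by `hCL∞ ↦ hEF`, or `hMaxND ↦ hEF` directly by `…NoDropConclIndTwoN_of_exitFree`). OURS. (folklore) -/
theorem strippingTailSwitchingEvenInfMaxNoDropClusterConclIndTwoN_of_exitFree
    (hEF : StrippingTailSwitchingEvenInfMaxNoDropExitFreeConclIndTwoN) :
    StrippingTailSwitchingEvenInfMaxNoDropClusterConclIndTwoN := by
  intro p hp2 k K _ _ _ _ _ O A₀ h₀ t core hrk R P s hR0 hN hrun hnd hhigh h2 hinf hwild hsw hev hbin hsat hsing hmax _hH hbelow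
  by_cases hAE : AffineExit.HasAffineExit O A₀ t p
  · subst hp2
    haveI : CharP K 2 := charP_of_injective_algebraMap (algebraMap k K).injective 2
    obtain ⟨hfg, htp, hfr, -⟩ := core
    exact AffineExit.concl_of_hasAffineExit Nat.prime_two O A₀ h₀ t hfg hfr hAE
  · exact hEF p hp2 k K O A₀ h₀ t core hrk R P s hR0 hN hrun hnd hhigh h2 hinf hwild hsw hev hbin hsat hsing hmax hAE hbelow

end DropSplit

end HevLeaf

end Summit.ResolutionOfSingularities.ResolutionOfSingularities.Theorems.SwitchingDichotomy

end
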